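/-
Origin: expansion seat `planner-pub-hodgecm-mc-period-1-g14-0`, handover #P50b 2026-08-20T11:08Z md5 1857b076e33f33258d2bb5fccb343994 (388 l., 38 decls; NEW additive drop-alone leaf; imports INSTALLED HodgeCM.Model.ArchSideOfTwist (RUN 43 #P43a) only; rowdeps none (independent of #P50a); ns HodgeCM.Model.ArchSideTerm; 0 proof-hole, 0 set_option maxHeartbeats, no records/Prop-defs/cites-as-hypotheses; cert lean-direct vs PKG oleans of record rc 0 / 0 warn wall 64 s, certs/axioms-twist50.log 38/38 trio 0 proof-holeAx; homonyms 0 vs PKG (incl. RUN-49 #CA44-#CA49) + theta-3/binder-1/sinst-1/carch-1 stages; pin R2 = the S pin TERM archSideOfT' with the nu-twisted eta-split on lines 0,1 AND the nu'-twisted split etaT2/etaT3 on lines 2,3, carch-1-g4 R2 spec STATUS l.13231) NAME LIST: HodgeCM.Model.ArchSideTerm.etaT_torus23 . HodgeCM.Model.ArchSideTerm.etaT₃_apply_mk_one . HodgeCM.Model.ArchSideTerm.seesaw34_archSideOfT' (`HOME/mc/pub-hodgecm-mc-period-1-g14/stage50/HodgeCM/Model/ArchSideOfTwist34.lean`, md5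 1857b076e33f, 388 lines);
landed by the second packager p2 gen 7 (p2-g7) in gate run 50 as `HodgeCM/Model/ArchSideOfTwist34.lean` (verbatim).
-/
/-
Origin: speedrun cell pub-hodgecm, MODEL-CONSTRUCTION sub-cell, lineage mc-period-1 (period lane), seat planner-pub-hodgecm-mc-period-1-g14-0
(gen 14), 2026-08-20.  Target in PKG: `HodgeCM/Model/ArchSideOfTwist34.lean` (NEW additive drop-alone leaf; RUN 49 material, row #P49b; imports
period-1's RUN-43 #P43a `Model/ArchSideOfTwist` only).  KERNEL only: 0 records / Prop-valued definitions / cites-as-hypotheses, 0 proof holes;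
closure ⊆ {propext, Classical.choice, Quot.sound}.
-/
import Summits.HodgeConjecture.HodgeCM.Model.ArchSideOfTwist

/-!
# The S pin TERM with a ν-twisted η-split on lines 0,1 AND a ν′-twisted η-split on lines 2,3 (pin R2)

carch-1-g4's design finding (R2) (STATUS 2026-08-20T10:15:45Z, «THE k = 2, 3 TOWER AT THE R1 PIN NEEDS A SECOND TWIST ν′ ON LINES 2/3»):
exactly as lines 0/1 needed the `U(V)(𝔸)`-character `ν` (R1, #P43a `etaT₀/etaT₁`), the conjugated lines 2/3 need a second character
`ν′ : CMAdelic L (frameD V) →* ℂˣ` (continuous, trivial on `U(V)(L⁺)`):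

  `etaT₂ V S η ν′ := (ν′⁻¹ ∘ fst) · eta₂ V S η`   — `η₂'(v,u) = ν′(v)⁻¹ · η(v, isoGL·diag(u,1)·isoGL⁻¹)`,
  `etaT₃ V S η ν′ := (ν′ ∘ fst) · eta₃ V S η`     — `η₃'(v,u) = ν′(v) · η(1, isoGL·diag(1,u)·isoGL⁻¹)`,

verbatim the `etaT₀/etaT₁` recipe of #P43a on the conjugated lines.  Since `ν′` cancels, LAYER B's conjugated splitting identity `hη23`
holds ON THE NOSE (`etaT_torus23`), so the see-saw junctions of lines 2,3 (`seesaw34_lineRepOf`, `op34_lineRepOf`) re-instantiate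
unchanged; the new line-3 datum is `etaT₃ V S η ν′ (x, 1) = ν′ x` (`etaT₃_apply_mk_one`), and #P43a's split is the case `ν′ = 1`
(`etaT₂_one`, `etaT₃_one`, `lineRepT'_one`).  The term

  `archSideOfT' V c hGR hGR₀ hGR₁ hGR₂ hGR₃ η hη hηc ν hν hνc ν′ hν′ hν′c h₁W A : ThetaAdelicSide V c`

is `archSideOfT` with `(P k).ω := lineRepT' … k := lineRepOf … (etaT₀ η ν) (etaT₁ η ν) (etaT₂ η ν′) (etaT₃ η ν′) k` (lines 0,1 carry
#P43a's `lineRepT … 0/1`: `lineRepT'_zero/one`, `archSideOfT'_P_ω_zero/one`), both Weil hypotheses PROVED from the same framed tree facts [Weil1964 III n°41 Thm 6 p. 193;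
GelbartRogawski1991 §3.1 Remark p. 457 L4–13] with the continuity ∕ rational triviality of `η, ν, ν′`, the archimedean component ∕
away-factor ∕ level companions verbatim, and the archimedean test data `A k : ArchLineInput V (lineRepT' … k)` as input.
(Identifier note: `lineRepT'`, `archSideOfT'` carry the ASCII prime U+0027.)

Binders of `archSideOfT'`, all told: the W pin's `hGR η hη hηc`, the four small-pair splittings `hGR₀ … hGR₃` [GR91 Prop. 3.1.1 p. 455],
the twists `ν, ν′` with `hν hν′ : ∀ γU ∈ CMRat L (frameD V), · γU = 1` and `hνc hν′c : Continuous ↑·`, `h₁W`, and `A`.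
ADDITIVE leaf: no existing declaration is touched; no records, no cited facts, no E-binder, no placeholders.
-/

set_option autoImplicit false

noncomputable section

open scoped Matrix SchwartzMap
open NumberField NumberField.mixedEmbedding
open Literature.NumberTheory.Automorphic Literature.NumberTheory.Weil1964
open Literature.NumberTheory.GelbartRogawski1991.UnitaryDualPair
open HodgeCM.Adelic HodgeCM.PerL34
open Literature.Geometry.ComplexHyperbolic.BallModel (U21)

namespace HodgeCM.Model

namespace ArchSideTerm

variable {L : CMField} {ι₁ : L →+* ℂ} (V : HermSpace3 L ι₁) (S : StubTree.SeesawDatum L)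

/-! ## §T The ν′-twisted η-split of lines 2,3 and its identities -/

section Split

variable (η : CMAdelic (L : Type) (frameD V) × CMAdelic (L : Type) (dW S) →* ℂˣ) (ν' : CMAdelic (L : Type) (frameD V) →* ℂˣ)

/-- `η₂' := (ν′⁻¹ ∘ fst) · η₂` — `η₂'(v,u) = ν′(v)⁻¹ · η(v, isoGL·diag(u,1)·isoGL⁻¹)`. -/
def etaT₂ : CMAdelic (L : Type) (frameD V) × CMAdelicOne (L : Type) →* ℂˣ :=
  ν'⁻¹.comp (MonoidHom.fst _ _) * eta₂ V S η

/-- `η₃' := (ν′ ∘ fst) · η₃` — `η₃'(v,u) = ν′(v) · η(1, isoGL·diag(1,u)·isoGL⁻¹)`: line 3 now carries the `U(V)`-datum `ν′`. -/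
def etaT₃ : CMAdelic (L : Type) (frameD V) × CMAdelicOne (L : Type) →* ℂˣ :=
  ν'.comp (MonoidHom.fst _ _) * eta₃ V S η

/-- (Ported verbatim from the HodgeCMPerL package; no docstring in the source.) -/
theorem etaT₂_def : etaT₂ V S η ν' = ν'⁻¹.comp (MonoidHom.fst _ _) * eta₂ V S η := rfl

/-- (Ported verbatim from the HodgeCMPerL package; no docstring in the source.) -/
theorem etaT₃_def : etaT₃ V S η ν' = ν'.comp (MonoidHom.fst _ _) * eta₃ V S η := rfl

/-- (Ported verbatim from the HodgeCMPerL package; no docstring in the source.) -/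
theorem etaT₂_apply (p : CMAdelic (L : Type) (frameD V) × CMAdelicOne (L : Type)) :
    etaT₂ V S η ν' p = (ν' p.1)⁻¹ * eta₂ V S η p := rfl

/-- (Ported verbatim from the HodgeCMPerL package; no docstring in the source.) -/
theorem etaT₃_apply (p : CMAdelic (L : Type) (frameD V) × CMAdelicOne (L : Type)) :
    etaT₃ V S η ν' p = ν' p.1 * eta₃ V S η p := rfl

/-- LAYER B's `hη23` for the twisted split: `ν′` cancels against `ν′⁻¹` (tree `cmConjEta_torus` via `eta_torus23`). -/
theorem etaT_torus23 (v : CMAdelic (L : Type) (frameD V)) (u₀ u₁ : CMAdelicOne (L : Type)) :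
    η (v, cmConjPlaneTorus (L : Type) (dW S) (dW' S) S.isoGL (isoGL_hg₀ S) (u₀, u₁)) =
      etaT₂ V S η ν' (v, u₀) * etaT₃ V S η ν' (v, u₁) := by
  rw [etaT₂_apply, etaT₃_apply, mul_mul_mul_comm, inv_mul_cancel, one_mul, eta_torus23]

/-- **the line-3 `U(V)`-datum of the twisted split**: `η₃'(x, 1) = ν′(x)` (the default split has `η₃(x, 1) = 1`, carch-1's
`HodgeCM.Model.eta₃_apply_mk_one` of RUN-49 #CA49 `ArchKTypeOfLineTables34`; not redeclared here). -/
theorem etaT₃_apply_mk_one (x : CMAdelic (L : Type) (frameD V)) : etaT₃ V S η ν' (x, 1) = ν' x := by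
  rw [etaT₃_apply]
  change ν' x * cmConjEta₁ (L : Type) (frameD V) (dW S) (dW' S) S.isoGL (isoGL_hg₀ S) η 1 = ν' x
  rw [map_one, mul_one]

/-- on `U(V) × 1` the twisted line-2 character is `ν′(x)⁻¹ · η(x, 1)`. -/
theorem etaT₂_apply_mk_one (x : CMAdelic (L : Type) (frameD V)) : etaT₂ V S η ν' (x, 1) = (ν' x)⁻¹ * η (x, 1) := by
  rw [etaT₂_apply]
  change (ν' x)⁻¹ * η (x, cmConjPlaneTorusInl (L : Type) (dW S) (dW' S) S.isoGL (isoGL_hg₀ S) 1) = _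
  rw [map_one]

/-- the split of #P43a (lines 2,3 default) is the case `ν′ = 1`. -/
theorem etaT₂_one : etaT₂ V S η 1 = eta₂ V S η := by
  ext p
  rw [etaT₂_apply, MonoidHom.one_apply, inv_one, one_mul]

/-- (Ported verbatim from the HodgeCMPerL package; no docstring in the source.) -/
theorem etaT₃_one : etaT₃ V S η 1 = eta₃ V S η := by
  ext p
  rw [etaT₃_apply, MonoidHom.one_apply, one_mul]

/-- continuity of `↑η₂'` from that of `↑η` (the W pin's `hηc`) and of `↑ν′`. -/
theorem continuous_etaT₂ (hηc : Continuous fun p => ((η p : ℂˣ) : ℂ)) (hν'c : Continuous fun v => ((ν' v : ℂˣ) : ℂ)) :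
    Continuous fun p => ((etaT₂ V S η ν' p : ℂˣ) : ℂ) := by
  have h : (fun p => ((etaT₂ V S η ν' p : ℂˣ) : ℂ)) =
      fun p => (((ν' p.1 : ℂˣ) : ℂ))⁻¹ * ((eta₂ V S η p : ℂˣ) : ℂ) := by
    funext p
    rw [etaT₂_apply, Units.val_mul, Units.val_inv_eq_inv_val]
  rw [h]
  exact ((hν'c.comp continuous_fst).inv₀ fun p => (ν' p.1).ne_zero).mul
    (continuous_cmConjEta₀ (L : Type) (frameD V) (dW S) (dW' S) S.isoGL (isoGL_hg₀ S) η hηc)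

/-- continuity of `↑η₃'` from that of `↑η` and of `↑ν′`. -/
theorem continuous_etaT₃ (hηc : Continuous fun p => ((η p : ℂˣ) : ℂ)) (hν'c : Continuous fun v => ((ν' v : ℂˣ) : ℂ)) :
    Continuous fun p => ((etaT₃ V S η ν' p : ℂˣ) : ℂ) := by
  have h : (fun p => ((etaT₃ V S η ν' p : ℂˣ) : ℂ)) =
      fun p => ((ν' p.1 : ℂˣ) : ℂ) * ((eta₃ V S η p : ℂˣ) : ℂ) := by
    funext p
    rw [etaT₃_apply, Units.val_mul]
  rw [h]
  exact (hν'c.comp continuous_fst).mul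
    (continuous_cmConjEta₁_comp_snd (L : Type) (frameD V) (dW S) (dW' S) S.isoGL (isoGL_hg₀ S) η hηc)

/-- `η₂'` is trivial at rational points when `η` (the W pin's `hη`) and `ν′` are. [GelbartRogawski1991 §3.1 Remark p. 457 L4–13] -/
theorem etaT₂_eq_one_of_rat (hη : ∀ γU ∈ CMRat (L : Type) (frameD V), ∀ γ ∈ CMRat (L : Type) (dW S), η (γU, γ) = 1)
    (hν' : ∀ γU ∈ CMRat (L : Type) (frameD V), ν' γU = 1) {v : CMAdelic (L : Type) (frameD V)} (hv : v ∈ CMRat (L : Type) (frameD V))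
    {t : ↥(Literature.NumberTheory.Automorphic.relNormOneIdeles (↥(maximalRealSubfield L)) L)}
    (ht : t ∈ Literature.NumberTheory.Automorphic.relNormOneRat (↥(maximalRealSubfield L)) L) :
    etaT₂ V S η ν' (v, (UnitaryGroup.cmAdelicOneEquivRelNormOne (L : Type)).symm t) = 1 := by
  rw [etaT₂_apply, hν' v hv, inv_one, one_mul]
  exact cmConjEta₀_eq_one_of_rat (L : Type) (frameD V) (dW S) (dW' S) S.isoGL (isoGL_hg₀ S) η hη hv ht

/-- `η₃'` is trivial at rational points when `η` and `ν′` are. [GelbartRogawski1991 §3.1 Remark p. 457 L4–13] -/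
theorem etaT₃_eq_one_of_rat (hη : ∀ γU ∈ CMRat (L : Type) (frameD V), ∀ γ ∈ CMRat (L : Type) (dW S), η (γU, γ) = 1)
    (hν' : ∀ γU ∈ CMRat (L : Type) (frameD V), ν' γU = 1) {v : CMAdelic (L : Type) (frameD V)} (hv : v ∈ CMRat (L : Type) (frameD V))
    {t : ↥(Literature.NumberTheory.Automorphic.relNormOneIdeles (↥(maximalRealSubfield L)) L)}
    (ht : t ∈ Literature.NumberTheory.Automorphic.relNormOneRat (↥(maximalRealSubfield L)) L) :
    etaT₃ V S η ν' (v, (UnitaryGroup.cmAdelicOneEquivRelNormOne (L : Type)).symm t) = 1 := by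
  rw [etaT₃_apply, hν' v hv, one_mul]
  exact cmConjEta₁_eq_one_of_rat (L : Type) (frameD V) (dW S) (dW' S) S.isoGL (isoGL_hg₀ S) η hη ht

end Split

/-! ## §W The doubly twisted line representations and their two Weil hypotheses, PROVED -/

section Weil

variable
  (hGR : (cmSplittingDatum (L : Type) finProdFinEquiv (frameD V) (frameD_real V) (frameD_ne V) (dW S) (dW_real S) (dW_ne S)).CompatibleSplitting)
  (hGR₀ : (cmSplittingDatum (L : Type) (e₁) (frameD V) (frameD_real V) (frameD_ne V) (lineVec (L : Type) (dW S 0))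
    (fun _ => dW_real S 0) (fun _ => dW_ne S 0)).CompatibleSplitting)
  (hGR₁ : (cmSplittingDatum (L : Type) (e₁) (frameD V) (frameD_real V) (frameD_ne V) (lineVec (L : Type) (dW S 1))
    (fun _ => dW_real S 1) (fun _ => dW_ne S 1)).CompatibleSplitting)
  (hGR₂ : (cmSplittingDatum (L : Type) (e₁) (frameD V) (frameD_real V) (frameD_ne V) (lineVec (L : Type) (dW' S 0))
    (fun _ => dW'_real S 0) (fun _ => dW'_ne S 0)).CompatibleSplitting)
  (hGR₃ : (cmSplittingDatum (L : Type) (e₁) (frameD V) (frameD_real V) (frameD_ne V) (lineVec (L : Type) (dW' S 1))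
    (fun _ => dW'_real S 1) (fun _ => dW'_ne S 1)).CompatibleSplitting)
  (η : CMAdelic (L : Type) (frameD V) × CMAdelic (L : Type) (dW S) →* ℂˣ) (ν ν' : CMAdelic (L : Type) (frameD V) →* ℂˣ)

/-- the S-side line representation of line `k` with the ν-TWISTED split on lines 0,1 and the ν′-TWISTED split on lines 2,3
(reducible wrapper of LAYER B's `lineRepOf`; `lineRepT' … 0/1` are definitionally `lineRepT … 0/1`). -/
abbrev lineRepT' (k : Fin 4) :
    Representation ℂ (↥(regimeSubgroup L V.Hm) × ↥(NumberField.relNormOneIdeles (↥(maximalRealSubfield L)) L))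
      (piSchwartzBruhat (↥(maximalRealSubfield L)) (Fin 3)) :=
  lineRepOf V S hGR hGR₀ hGR₁ hGR₂ hGR₃ (etaT₀ V S η ν) (etaT₁ V S η ν) (etaT₂ V S η ν') (etaT₃ V S η ν') k

/-- `![a, b, c, d] 0 = a` and `![a, b, c, d] 1 = b` by `rfl` (used to read lines 0,1 off `lineRep` without unfolding the conjugated lines). -/
theorem vecFour_apply_zero {α : Type*} (a b c d : α) : ![a, b, c, d] 0 = a := rfl

/-- (Ported verbatim from the HodgeCMPerL package; no docstring in the source.) -/
theorem vecFour_apply_one {α : Type*} (a b c d : α) : ![a, b, c, d] 1 = b := rfl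

/-- line 0 of the doubly twisted family is #P43a's `lineRepT … 0` (the `ν′`-twist only touches lines 2,3). -/
theorem lineRepT'_zero : lineRepT' V S hGR hGR₀ hGR₁ hGR₂ hGR₃ η ν ν' 0 = lineRepT V S hGR hGR₀ hGR₁ hGR₂ hGR₃ η ν 0 :=
  (congrArg (fun ρ => MonoidHom.comp ρ
      (((cmFrameEquiv (L : Type) (frameG V) V.Hm (frameD V) (frame_congr V)).toMonoidHom.comp (regimeSubgroup L V.Hm).subtype).prodMap
        (MonoidHom.id _))) (vecFour_apply_zero _ _ _ _)).trans
    (congrArg (fun ρ => MonoidHom.comp ρ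
      (((cmFrameEquiv (L : Type) (frameG V) V.Hm (frameD V) (frame_congr V)).toMonoidHom.comp (regimeSubgroup L V.Hm).subtype).prodMap
        (MonoidHom.id _))) (vecFour_apply_zero _ _ _ _)).symm

/-- line 1 of the doubly twisted family is #P43a's `lineRepT … 1`. -/
theorem lineRepT'_one : lineRepT' V S hGR hGR₀ hGR₁ hGR₂ hGR₃ η ν ν' 1 = lineRepT V S hGR hGR₀ hGR₁ hGR₂ hGR₃ η ν 1 :=
  (congrArg (fun ρ => MonoidHom.comp ρ
      (((cmFrameEquiv (L : Type) (frameG V) V.Hm (frameD V) (frame_congr V)).toMonoidHom.comp (regimeSubgroup L V.Hm).subtype).prodMap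
        (MonoidHom.id _))) (vecFour_apply_one _ _ _ _)).trans
    (congrArg (fun ρ => MonoidHom.comp ρ
      (((cmFrameEquiv (L : Type) (frameG V) V.Hm (frameD V) (frame_congr V)).toMonoidHom.comp (regimeSubgroup L V.Hm).subtype).prodMap
        (MonoidHom.id _))) (vecFour_apply_one _ _ _ _)).symm

/-- at `ν′ = 1` the doubly twisted line representations are #P43a's. -/
theorem lineRepT'_one_right (k : Fin 4) :
    lineRepT' V S hGR hGR₀ hGR₁ hGR₂ hGR₃ η ν 1 k = lineRepT V S hGR hGR₀ hGR₁ hGR₂ hGR₃ η ν k := by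
  rw [lineRepT', etaT₂_one, etaT₃_one]

/-- **(W-maj⁺) PROVED for the four doubly twisted lines** [Weil1964 III n°41 Thm 6 p. 193]. -/
theorem hasThetaMajorants_lineRepT' (hηc : Continuous fun p => ((η p : ℂˣ) : ℂ)) (hνc : Continuous fun v => ((ν v : ℂˣ) : ℂ))
    (hν'c : Continuous fun v => ((ν' v : ℂˣ) : ℂ))
    (h₁W : (∀ j, 0 < (ι₁ (dW S j)).re) ∨ ∀ j, (ι₁ (dW S j)).re < 0) (k : Fin 4) :
    HasThetaMajorants fun (p : ↥(regimeSubgroup L V.Hm) × ↥(NumberField.relNormOneIdeles (↥(maximalRealSubfield L)) L))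
      (φ : piSchwartzBruhat (↥(maximalRealSubfield L)) (Fin 3)) => lineRepT' V S hGR hGR₀ hGR₁ hGR₂ hGR₃ η ν ν' k p φ := by
  fin_cases k
  · exact hasThetaMajorants_cmLineRepFin₀_framed_of_signs (L : Type) finProdFinEquiv e₁ (frameD V) (frameD_real V) (frameD_ne V)
      (dW S) (dW_real S) (dW_ne S) hGR hGR₀ hGR₁ (etaT₀ V S η ν) (frame_congr V) (regimeSubgroup L V.Hm) ι₁ (frameD_sign_ι₁' V) h₁W
      (frameD_sign_of_ne V) (continuous_etaT₀ V S η ν hηc hνc)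
  · exact hasThetaMajorants_cmLineRepFin₁_framed_of_signs (L : Type) finProdFinEquiv e₁ (frameD V) (frameD_real V) (frameD_ne V)
      (dW S) (dW_real S) (dW_ne S) hGR hGR₀ hGR₁ (etaT₁ V S η ν) (frame_congr V) (regimeSubgroup L V.Hm) ι₁ (frameD_sign_ι₁' V) h₁W
      (frameD_sign_of_ne V) (continuous_etaT₁ V S η ν hηc hνc)
  · exact hasThetaMajorants_cmConjLineRepFin₀_framed_of_signs (L : Type) finProdFinEquiv e₁ (frameD V) (frameD_real V) (frameD_ne V)
      (dW S) (dW_real S) (dW_ne S) (dW' S) (dW'_real S) (dW'_ne S) S.isoGL (isoGL_hg₀ S) hGR hGR₂ hGR₃ (etaT₂ V S η ν') (frame_congr V)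
      (regimeSubgroup L V.Hm) ι₁ (frameD_sign_ι₁' V) h₁W (frameD_sign_of_ne V) (continuous_etaT₂ V S η ν' hηc hν'c)
  · exact hasThetaMajorants_cmConjLineRepFin₁_framed_of_signs (L : Type) finProdFinEquiv e₁ (frameD V) (frameD_real V) (frameD_ne V)
      (dW S) (dW_real S) (dW_ne S) (dW' S) (dW'_real S) (dW'_ne S) S.isoGL (isoGL_hg₀ S) hGR hGR₂ hGR₃ (etaT₃ V S η ν') (frame_congr V)
      (regimeSubgroup L V.Hm) ι₁ (frameD_sign_ι₁' V) h₁W (frameD_sign_of_ne V) (continuous_etaT₃ V S η ν' hηc hν'c)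

/-- **(W-rat⁺) PROVED for the four doubly twisted lines** [GelbartRogawski1991 §3.1 Remark p. 457 L4–13]: `lineRepT' k (γ, t)`
stabilises `Θ` for `γ ∈ Γ = regimeRat` and `t ∈ U(1)(L⁺)`, from the rationality binders `hη` (W pin), `hν` and `hν′`. -/
theorem lineRepT'_mem_thetaStabilizerEnd
    (hη : ∀ γU ∈ CMRat (L : Type) (frameD V), ∀ γ ∈ CMRat (L : Type) (dW S), η (γU, γ) = 1)
    (hν : ∀ γU ∈ CMRat (L : Type) (frameD V), ν γU = 1) (hν' : ∀ γU ∈ CMRat (L : Type) (frameD V), ν' γU = 1) (k : Fin 4) :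
    ∀ γ ∈ (V.latticeModel printFact_unitaryCompact_holds).Γ, ∀ t ∈ NumberField.relNormOneRat (↥(maximalRealSubfield L)) L,
      lineRepT' V S hGR hGR₀ hGR₁ hGR₂ hGR₃ η ν ν' k (γ, t) ∈ thetaStabilizerEnd (↥(maximalRealSubfield L)) (Fin 3) := by
  fin_cases k
  · exact forall_cmLineRepFin₀_framed_mem_thetaStabilizerEnd (L : Type) finProdFinEquiv e₁ (frameD V) (frameD_real V) (frameD_ne V)
      (dW S) (dW_real S) (dW_ne S) hGR hGR₀ hGR₁ (etaT₀ V S η ν) (frame_congr V) (regimeSubgroup L V.Hm)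
      (V.latticeModel printFact_unitaryCompact_holds).Γ (fun γ hγ => (mem_regimeRat_iff γ).1 hγ)
      (fun v hv t ht => etaT₀_eq_one_of_rat V S η ν hη hν hv ht)
  · exact forall_cmLineRepFin₁_framed_mem_thetaStabilizerEnd (L : Type) finProdFinEquiv e₁ (frameD V) (frameD_real V) (frameD_ne V)
      (dW S) (dW_real S) (dW_ne S) hGR hGR₀ hGR₁ (etaT₁ V S η ν) (frame_congr V) (regimeSubgroup L V.Hm)
      (V.latticeModel printFact_unitaryCompact_holds).Γ (fun γ hγ => (mem_regimeRat_iff γ).1 hγ)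
      (fun v hv t ht => etaT₁_eq_one_of_rat V S η ν hη hν hv ht)
  · exact forall_cmConjLineRepFin₀_framed_mem_thetaStabilizerEnd (L : Type) finProdFinEquiv e₁ (frameD V) (frameD_real V) (frameD_ne V)
      (dW S) (dW_real S) (dW_ne S) (dW' S) (dW'_real S) (dW'_ne S) S.isoGL (isoGL_hg₀ S) hGR hGR₂ hGR₃ (etaT₂ V S η ν') (frame_congr V)
      (regimeSubgroup L V.Hm) (V.latticeModel printFact_unitaryCompact_holds).Γ (fun γ hγ => (mem_regimeRat_iff γ).1 hγ)
      (fun v hv t ht => etaT₂_eq_one_of_rat V S η ν' hη hν' hv ht)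
  · exact forall_cmConjLineRepFin₁_framed_mem_thetaStabilizerEnd (L : Type) finProdFinEquiv e₁ (frameD V) (frameD_real V) (frameD_ne V)
      (dW S) (dW_real S) (dW_ne S) (dW' S) (dW'_real S) (dW'_ne S) S.isoGL (isoGL_hg₀ S) hGR hGR₂ hGR₃ (etaT₃ V S η ν') (frame_congr V)
      (regimeSubgroup L V.Hm) (V.latticeModel printFact_unitaryCompact_holds).Γ (fun γ hγ => (mem_regimeRat_iff γ).1 hγ)
      (fun v hv t ht => etaT₃_eq_one_of_rat V S η ν' hη hν' hv ht)

end Weil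

/-! ## §S The S pin term with the doubly twisted split (pin R2) -/

section Term

variable (c : SeesawCtx L)
  (hGR : (cmSplittingDatum (L : Type) finProdFinEquiv (frameD V) (frameD_real V) (frameD_ne V) (dW c.D) (dW_real c.D)
    (dW_ne c.D)).CompatibleSplitting)
  (hGR₀ : (cmSplittingDatum (L : Type) (e₁) (frameD V) (frameD_real V) (frameD_ne V) (lineVec (L : Type) (dW c.D 0))
    (fun _ => dW_real c.D 0) (fun _ => dW_ne c.D 0)).CompatibleSplitting)
  (hGR₁ : (cmSplittingDatum (L : Type) (e₁) (frameD V) (frameD_real V) (frameD_ne V) (lineVec (L : Type) (dW c.D 1))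
    (fun _ => dW_real c.D 1) (fun _ => dW_ne c.D 1)).CompatibleSplitting)
  (hGR₂ : (cmSplittingDatum (L : Type) (e₁) (frameD V) (frameD_real V) (frameD_ne V) (lineVec (L : Type) (dW' c.D 0))
    (fun _ => dW'_real c.D 0) (fun _ => dW'_ne c.D 0)).CompatibleSplitting)
  (hGR₃ : (cmSplittingDatum (L : Type) (e₁) (frameD V) (frameD_real V) (frameD_ne V) (lineVec (L : Type) (dW' c.D 1))
    (fun _ => dW'_real c.D 1) (fun _ => dW'_ne c.D 1)).CompatibleSplitting)
  (η : CMAdelic (L : Type) (frameD V) × CMAdelic (L : Type) (dW c.D) →* ℂˣ)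
  (hη : ∀ γU ∈ CMRat (L : Type) (frameD V), ∀ γ ∈ CMRat (L : Type) (dW c.D), η (γU, γ) = 1)
  (hηc : Continuous fun p => ((η p : ℂˣ) : ℂ))
  (ν : CMAdelic (L : Type) (frameD V) →* ℂˣ)
  (hν : ∀ γU ∈ CMRat (L : Type) (frameD V), ν γU = 1)
  (hνc : Continuous fun v => ((ν v : ℂˣ) : ℂ))
  (ν' : CMAdelic (L : Type) (frameD V) →* ℂˣ)
  (hν' : ∀ γU ∈ CMRat (L : Type) (frameD V), ν' γU = 1)
  (hν'c : Continuous fun v => ((ν' v : ℂˣ) : ℂ))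
  (h₁W : (∀ j, 0 < (ι₁ (dW c.D j)).re) ∨ ∀ j, (ι₁ (dW c.D j)).re < 0)
  (A : ∀ k : Fin 4, ArchLineInput V (lineRepT' V c.D hGR hGR₀ hGR₁ hGR₂ hGR₃ η ν ν' k))

/-- **THE DOUBLY TWISTED S PIN TERM (R2)** `archSideOfT' V c … : ThetaAdelicSide V c` — `(P k).ω := lineRepT' k` on the nose (lines 0,1
twisted by `ν`, lines 2,3 by `ν′`), `(P k).ΓU := (V.latticeModel hP).Γ`, the archimedean component ∕ away-factor ∕ commutation ∕ rational
splitting of #1097 with their finite-level companions of `ArchSideLevel`, both Weil hypotheses PROVED (§W); `A k` input. -/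
def archSideOfT' : ThetaAdelicSide V c where
  P k :=
    { ΓU := (V.latticeModel printFact_unitaryCompact_holds).Γ
      ω := lineRepT' V c.D hGR hGR₀ hGR₁ hGR₂ hGR₃ η ν ν' k
      Φinf := (A k).Φinf
      x₀ := (A k).x₀
      hx₀ := (A k).hx₀
      w := (A k).w
      weight := (A k).weight
      majorants := hasThetaMajorants_lineRepT' V c.D hGR hGR₀ hGR₁ hGR₂ hGR₃ η ν ν' hηc hνc hν'c h₁W k
      theta_rat := lineRepT'_mem_thetaStabilizerEnd V c.D hGR hGR₀ hGR₁ hGR₂ hGR₃ η ν ν' hη hν hν' k }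
  hΓU _ := rfl
  ιinf := archInfOf V
  Gfin := archFinOf V
  comm_fin := commute_archFinOf_archInfOf V
  rat_split := rat_split_archInfOf V
  fin_mem_Gfin := inv_finAdelic_mem_archFinOf V      -- (L3b), `HodgeCM/Model/ArchSideLevel.lean`
  rat_split_level := rat_split_level_archInfOf V     -- (L3),  `HodgeCM/Model/ArchSideLevel.lean`

/-! ### read-backs (`rfl`, except the two line-0/1 identifications, which are `lineRepT'_zero/one`) -/

/-- (Ported verbatim from the HodgeCMPerL package; no docstring in the source.) -/
@[simp] theorem archSideOfT'_P_ω (k : Fin 4) :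
    ((archSideOfT' V c hGR hGR₀ hGR₁ hGR₂ hGR₃ η hη hηc ν hν hνc ν' hν' hν'c h₁W A).P k).ω =
      lineRepOf V c.D hGR hGR₀ hGR₁ hGR₂ hGR₃ (etaT₀ V c.D η ν) (etaT₁ V c.D η ν) (etaT₂ V c.D η ν') (etaT₃ V c.D η ν') k := rfl

/-- lines 0,1 of the doubly twisted term carry #P43a's `lineRepT … 0/1` (the `ν′`-twist only touches lines 2,3). -/
theorem archSideOfT'_P_ω_zero :
    ((archSideOfT' V c hGR hGR₀ hGR₁ hGR₂ hGR₃ η hη hηc ν hν hνc ν' hν' hν'c h₁W A).P 0).ω =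
      lineRepT V c.D hGR hGR₀ hGR₁ hGR₂ hGR₃ η ν 0 :=
  lineRepT'_zero V c.D hGR hGR₀ hGR₁ hGR₂ hGR₃ η ν ν'

/-- (Ported verbatim from the HodgeCMPerL package; no docstring in the source.) -/
theorem archSideOfT'_P_ω_one :
    ((archSideOfT' V c hGR hGR₀ hGR₁ hGR₂ hGR₃ η hη hηc ν hν hνc ν' hν' hν'c h₁W A).P 1).ω =
      lineRepT V c.D hGR hGR₀ hGR₁ hGR₂ hGR₃ η ν 1 :=
  lineRepT'_one V c.D hGR hGR₀ hGR₁ hGR₂ hGR₃ η ν ν'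

/-- (Ported verbatim from the HodgeCMPerL package; no docstring in the source.) -/
@[simp] theorem archSideOfT'_P_ΓU (k : Fin 4) :
    ((archSideOfT' V c hGR hGR₀ hGR₁ hGR₂ hGR₃ η hη hηc ν hν hνc ν' hν' hν'c h₁W A).P k).ΓU =
      (V.latticeModel printFact_unitaryCompact_holds).Γ := rfl

/-- (Ported verbatim from the HodgeCMPerL package; no docstring in the source.) -/
@[simp] theorem archSideOfT'_P_Φinf (k : Fin 4) :
    ((archSideOfT' V c hGR hGR₀ hGR₁ hGR₂ hGR₃ η hη hηc ν hν hνc ν' hν' hν'c h₁W A).P k).Φinf = (A k).Φinf := rfl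

/-- (Ported verbatim from the HodgeCMPerL package; no docstring in the source.) -/
@[simp] theorem archSideOfT'_P_x₀ (k : Fin 4) :
    ((archSideOfT' V c hGR hGR₀ hGR₁ hGR₂ hGR₃ η hη hηc ν hν hνc ν' hν' hν'c h₁W A).P k).x₀ = (A k).x₀ := rfl

/-- (Ported verbatim from the HodgeCMPerL package; no docstring in the source.) -/
@[simp] theorem archSideOfT'_P_w (k : Fin 4) :
    ((archSideOfT' V c hGR hGR₀ hGR₁ hGR₂ hGR₃ η hη hηc ν hν hνc ν' hν' hν'c h₁W A).P k).w = (A k).w := rfl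

/-- (Ported verbatim from the HodgeCMPerL package; no docstring in the source.) -/
@[simp] theorem archSideOfT'_ιinf :
    (archSideOfT' V c hGR hGR₀ hGR₁ hGR₂ hGR₃ η hη hηc ν hν hνc ν' hν' hν'c h₁W A).ιinf = archInfOf V := rfl

/-- (Ported verbatim from the HodgeCMPerL package; no docstring in the source.) -/
@[simp] theorem archSideOfT'_Gfin :
    (archSideOfT' V c hGR hGR₀ hGR₁ hGR₂ hGR₃ η hη hηc ν hν hνc ν' hν' hν'c h₁W A).Gfin = archFinOf V := rfl

/-- (L3b) AT THE TERM: `regimeEquiv … (e.symm (1, k_f)) ∈ (archSideOfT' V c …).Gfin` for every finite-adelic `k_f`. -/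
theorem regimeEquiv_prodSymm_one_mem_archSideOfT'_Gfin (hV : IsAnisotropic L V.Hm)
    (kf : ↥(UnitaryGroup.finAdelic (↥(maximalRealSubfield L)) (L : Type) (IsCMField.complexConj L) 3 V.Hm)) :
    (Adelic.regimeEquiv L V.Hm hV ((UnitaryGroup.cmAdelicProdEquiv (L : Type) 3 V.Hm).symm (1, kf)) :
        (V.latticeModel printFact_unitaryCompact_holds).G) ∈
      (archSideOfT' V c hGR hGR₀ hGR₁ hGR₂ hGR₃ η hη hηc ν hν hνc ν' hν' hν'c h₁W A).Gfin :=
  regimeEquiv_prodSymm_one_mem_archFinOf V hV kf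

/-- D-1′ `hι` AT THE TERM (binder-1 `Real34PinJunctions.hι`, verbatim right-hand side). -/
theorem archSideOfT'_ιinf_apply (hV : IsAnisotropic L V.Hm) (u : U21) :
    (archSideOfT' V c hGR hGR₀ hGR₁ hGR₂ hGR₃ η hη hηc ν hν hνc ν' hν' hν'c h₁W A).ιinf u =
      Adelic.regimeEquiv L V.Hm hV
        (UnitaryGroup.archSectionU21CM (L : Type) ι₁ V.Hm V.sylvesterFrame (sylvesterFrame_J V) u) :=
  archInfOf_eq_regimeEquiv V hV u

/-! ### the binder-1 junctions, SPECIALISED to the doubly twisted term (no η-split hypothesis left) -/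

/-- **`op`** of `SeesawCore.ofOp` for the doubly twisted term: LAYER B `op_lineRepOf` with `hη01 := etaT_torus01`. -/
theorem op_archSideOfT' (g : ↥(regimeSubgroup L V.Hm)) (t : SeesawTorus (↥(maximalRealSubfield L)) L)
    (φ₁ φ₂ : piSchwartzBruhat (↥(maximalRealSubfield L)) (Fin 3)) :
    cmPairRepTwist (L : Type) finProdFinEquiv (frameD V) (frameD_real V) (frameD_ne V) (dW c.D) (dW_real c.D) (dW_ne c.D) hGR η
        ((cmFrameEquiv (L : Type) (frameG V) V.Hm (frameD V) (frame_congr V)) (g : ↥(HodgeCM.Adelic.adelicUnitaryGroup (L : Type) V.Hm)),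
          cmAdelicEquiv (L : Type) 2 (Matrix.diagonal (dW c.D)) (c.D.jT₁₂ t)) (tau12 V c.D φ₁ φ₂) =
      tau12 V c.D (((archSideOfT' V c hGR hGR₀ hGR₁ hGR₂ hGR₃ η hη hηc ν hν hνc ν' hν' hν'c h₁W A).P 0).ω (g, SeesawTorus.fst _ L t) φ₁)
        (((archSideOfT' V c hGR hGR₀ hGR₁ hGR₂ hGR₃ η hη hηc ν hν hνc ν' hν' hν'c h₁W A).P 1).ω (g, SeesawTorus.snd _ L t) φ₂) :=
  op_lineRepOf V c.D hGR hGR₀ hGR₁ hGR₂ hGR₃ η _ _ _ _ g t (etaT_torus01 V c.D η ν) φ₁ φ₂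

/-- **`seesaw`** of `SeesawHyp34` for the doubly twisted term: LAYER B `seesaw34_lineRepOf` with `hη23 := etaT_torus23` (lines 2,3 twisted
by `ν′`, which cancels). -/
theorem seesaw34_archSideOfT' (g : ↥(regimeSubgroup L V.Hm)) (t : SeesawTorus (↥(maximalRealSubfield L)) L)
    (φ₂ φ₃ : piSchwartzBruhat (↥(maximalRealSubfield L)) (Fin 3)) :
    thetaDistLM (↥(maximalRealSubfield L)) (Fin 6)
        (cmPairRepTwist (L : Type) finProdFinEquiv (frameD V) (frameD_real V) (frameD_ne V) (dW c.D) (dW_real c.D) (dW_ne c.D) hGR η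
          ((cmFrameEquiv (L : Type) (frameG V) V.Hm (frameD V) (frame_congr V)) (g : ↥(HodgeCM.Adelic.adelicUnitaryGroup (L : Type) V.Hm)),
            cmAdelicEquiv (L : Type) 2 (Matrix.diagonal (dW c.D)) (c.D.jT₃₄ t)) (tau34 V c.D φ₂ φ₃)) =
      thetaDistLM (↥(maximalRealSubfield L)) (Fin 3)
          (((archSideOfT' V c hGR hGR₀ hGR₁ hGR₂ hGR₃ η hη hηc ν hν hνc ν' hν' hν'c h₁W A).P 2).ω (g, SeesawTorus.fst _ L t) φ₂) *
        thetaDistLM (↥(maximalRealSubfield L)) (Fin 3)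
          (((archSideOfT' V c hGR hGR₀ hGR₁ hGR₂ hGR₃ η hη hηc ν hν hνc ν' hν' hν'c h₁W A).P 3).ω (g, SeesawTorus.snd _ L t) φ₃) :=
  seesaw34_lineRepOf V c.D hGR hGR₀ hGR₁ hGR₂ hGR₃ η _ _ _ _ g t (etaT_torus23 V c.D η ν') φ₂ φ₃

/-- the operator-level version for lines `2,3`: LAYER B `op34_lineRepOf` with `hη23 := etaT_torus23`. -/
theorem op34_archSideOfT' (g : ↥(regimeSubgroup L V.Hm)) (t : SeesawTorus (↥(maximalRealSubfield L)) L)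
    (φ₂ φ₃ : piSchwartzBruhat (↥(maximalRealSubfield L)) (Fin 3)) :
    cmPairRepTwist (L : Type) finProdFinEquiv (frameD V) (frameD_real V) (frameD_ne V) (dW c.D) (dW_real c.D) (dW_ne c.D) hGR η
        ((cmFrameEquiv (L : Type) (frameG V) V.Hm (frameD V) (frame_congr V)) (g : ↥(HodgeCM.Adelic.adelicUnitaryGroup (L : Type) V.Hm)),
          cmAdelicEquiv (L : Type) 2 (Matrix.diagonal (dW c.D)) (c.D.jT₃₄ t)) (tau34 V c.D φ₂ φ₃) =
      tau34 V c.D (((archSideOfT' V c hGR hGR₀ hGR₁ hGR₂ hGR₃ η hη hηc ν hν hνc ν' hν' hν'c h₁W A).P 2).ω (g, SeesawTorus.fst _ L t) φ₂)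
        (((archSideOfT' V c hGR hGR₀ hGR₁ hGR₂ hGR₃ η hη hηc ν hν hνc ν' hν' hν'c h₁W A).P 3).ω (g, SeesawTorus.snd _ L t) φ₃) :=
  op34_lineRepOf V c.D hGR hGR₀ hGR₁ hGR₂ hGR₃ η _ _ _ _ g t (etaT_torus23 V c.D η ν') φ₂ φ₃

end Term

end ArchSideTerm

end HodgeCM.Model

end
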